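import Mathlib.GroupTheory.Perm.Sign
import Mathlib.GroupTheory.Perm.Fin
import Mathlib.Data.Real.Basic
import Mathlib.Algebra.BigOperators.Fin
import Mathlib.Tactic
import HarnessLib

/-!
# The `W⁺` selection rule `Hom_{W⁺}(Sym²Λ², Λ²) = 0` in coordinates

Support file for the line `WardDefectSketch` of crux `CurvatureAmnesia` (item
stmt-QuantumFields-16192, routes `ScalingWindowSplit` / `CoincidenceRotationBootstrap`): the
registered stub `lambdaTwo_selectionRule`, proved verbatim.  Pure proof file: no definitions,
no notation.

**Statement.**  Let `W⁺ ⊂ O(4)` be the proper hyperoctahedral group: signed permutation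
matrices of determinant `+1`, i.e. pairs `(π, ε)` of a permutation `π` of `Fin 4` and signs
`ε : Fin 4 → {±1}` with `sign π · ∏ᵢ εᵢ = 1`, acting by `e_v ↦ ε_v e_{π v}`.  A `W⁺`-equivariant
linear map `Sym²(Λ²ℝ⁴) → Λ²ℝ⁴` has matrix coefficients
`K a b m n r s = ⟨e_a ∧ e_b, φ((e_m ∧ e_n) ⊙ (e_r ∧ e_s))⟩`, antisymmetric in `(a,b)`, `(m,n)`,
`(r,s)`, symmetric under `(m,n) ↔ (r,s)` and invariant:
`ε_a ε_b ε_m ε_n ε_r ε_s · K (πa)(πb)(πm)(πn)(πr)(πs) = K a b m n r s`.  Every such `K` vanishes.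

**Proof.**  For a tuple `t = (a,b,m,n,r,s)` let `c_v` be the number of occurrences of the value
`v : Fin 4` in `t`.
* *Double flips* (`flip_kill`): `π = 1`, `ε = -1` exactly at two values `u ≠ w`.  Invariance
  gives `K t = (-1)^{c_u + c_w} K t`, so `K t = 0` as soon as `c_u + c_w` is odd.  The flips
  `{0,1}` and `{0,2}` already kill every tuple whose four count parities are not all equal (the
  parities sum to `6 ≡ 0 (mod 2)`).
* *Diagonal pairs*: `a = b`, `m = n` or `r = s` gives `K t = -K t` by antisymmetry.
* With three honest pairs and all parities equal the counts are `(3,1,1,1)` — a *star*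
  `(u,x | u,y | u,z)` — or `(2,2,2,0)` — a *triangle* `(u,v | u,w | v,w)` with the fourth value
  `q` absent.  `star_kill`: `π = (y z)`, `ε = -1` at `x`, then the pair symmetry, gives
  `K t = -K t`.  `triangle_kill`: `π = (u v)`, `ε = -1` at `q`, then antisymmetry of the first
  pair and the pair symmetry, gives `K t = -K t`.
* `verdict` / `lambdaTwo_selectionRule`: that every tuple falls under one of these rules (in one
  of the `2 × 2 × 2` orientations of the star / triangle inside the three ordered pairs) is a
  Boolean evaluation over `Fin 4`, checked by `decide`; each rule is then discharged by the
  lemmas above, the orientations being reduced to the basic one by the antisymmetries.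

References: folklore (invariant theory of the hyperoctahedral group `W(B₄)`; the vanishing was
also checked independently by a signed-orbit enumeration: 126 coordinates, 9 signed orbits, all
forced to zero).
-/

namespace Summit.QuantumFields.YangMills.Cruxes.CurvatureAmnesia.WardDefect

open scoped BigOperators

namespace SelectionRule

variable {K : Fin 4 → Fin 4 → Fin 4 → Fin 4 → Fin 4 → Fin 4 → ℝ}

/-- Double flip: if an odd number of the six indices lie in `{u, w}` (`u ≠ w`), the `W⁺`-invariance
under `π = 1`, `ε = -𝟙_{u,w} + 𝟙_{rest}` forces `K a b m n r s = 0`. [folklore] -/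
theorem flip_kill
    (h5 : ∀ (π : Equiv.Perm (Fin 4)) (ε : Fin 4 → ℝ), (∀ i, ε i = 1 ∨ ε i = -1) →
      ((Equiv.Perm.sign π : ℤ) : ℝ) * ∏ i, ε i = 1 →
      ∀ a b m n r s, ε a * ε b * ε m * ε n * ε r * ε s * K (π a) (π b) (π m) (π n) (π r) (π s)
        = K a b m n r s)
    {u w : Fin 4} (huw : u ≠ w) {a b m n r s : Fin 4}
    (hodd : ([a, b, m, n, r, s].countP (fun x => decide (x = u ∨ x = w))) % 2 = 1) :
    K a b m n r s = 0 := by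
  have hε1 : ∀ i : Fin 4, (if i = u ∨ i = w then (-1 : ℝ) else 1) = 1 ∨
      (if i = u ∨ i = w then (-1 : ℝ) else 1) = -1 := by
    intro i; split_ifs <;> simp
  have hprod : ((Equiv.Perm.sign (1 : Equiv.Perm (Fin 4)) : ℤ) : ℝ) *
      ∏ i : Fin 4, (if i = u ∨ i = w then (-1 : ℝ) else 1) = 1 := by
    rw [Equiv.Perm.sign_one, Units.val_one, Int.cast_one, one_mul, Fin.prod_univ_four]
    revert huw
    fin_cases u <;> fin_cases w <;> simp
  have key := h5 1 (fun i => if i = u ∨ i = w then (-1 : ℝ) else 1) hε1 hprod a b m n r s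
  simp only [Equiv.Perm.coe_one, id_eq] at key
  have hsign : (if a = u ∨ a = w then (-1 : ℝ) else 1) * (if b = u ∨ b = w then (-1 : ℝ) else 1) *
      (if m = u ∨ m = w then (-1 : ℝ) else 1) * (if n = u ∨ n = w then (-1 : ℝ) else 1) *
      (if r = u ∨ r = w then (-1 : ℝ) else 1) * (if s = u ∨ s = w then (-1 : ℝ) else 1)
      = (-1 : ℝ) ^ ([a, b, m, n, r, s].countP (fun x => decide (x = u ∨ x = w))) := by
    simp only [List.countP_cons, List.countP_nil, decide_eq_true_eq, pow_add, pow_zero]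
    simp only [pow_ite, pow_one, pow_zero]
    ring
  rw [hsign, (Nat.odd_iff.mpr hodd).neg_one_pow] at key
  linarith

/-- Star: for pairwise distinct `u, x, y, z` the coefficient `K u x u y u z` vanishes (`π = (y z)`,
`ε = -1` exactly at `x`, then the pair symmetry `(m,n) ↔ (r,s)`). [folklore] -/
theorem star_kill
    (h4 : ∀ a b m n r s, K a b r s m n = K a b m n r s)
    (h5 : ∀ (π : Equiv.Perm (Fin 4)) (ε : Fin 4 → ℝ), (∀ i, ε i = 1 ∨ ε i = -1) →
      ((Equiv.Perm.sign π : ℤ) : ℝ) * ∏ i, ε i = 1 →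
      ∀ a b m n r s, ε a * ε b * ε m * ε n * ε r * ε s * K (π a) (π b) (π m) (π n) (π r) (π s)
        = K a b m n r s)
    {u x y z : Fin 4} (hux : u ≠ x) (huy : u ≠ y) (huz : u ≠ z) (hxy : x ≠ y) (hxz : x ≠ z)
    (hyz : y ≠ z) : K u x u y u z = 0 := by
  have hε1 : ∀ i : Fin 4, (if i = x then (-1 : ℝ) else 1) = 1 ∨
      (if i = x then (-1 : ℝ) else 1) = -1 := by
    intro i; split_ifs <;> simp
  have hprod : ((Equiv.Perm.sign (Equiv.swap y z) : ℤ) : ℝ) *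
      ∏ i : Fin 4, (if i = x then (-1 : ℝ) else 1) = 1 := by
    rw [Equiv.Perm.sign_swap hyz, Finset.prod_ite_eq']
    simp
  have key := h5 (Equiv.swap y z) (fun i => if i = x then (-1 : ℝ) else 1) hε1 hprod u x u y u z
  rw [Equiv.swap_apply_of_ne_of_ne huy huz, Equiv.swap_apply_of_ne_of_ne hxy hxz,
    Equiv.swap_apply_left, Equiv.swap_apply_right, if_neg hux, if_neg hxy.symm, if_neg hxz.symm,
    if_pos rfl, h4 u x u y u z] at key
  linarith

/-- Triangle: for pairwise distinct `u, v, w` the coefficient `K u v u w v w` vanishes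
(`π = (u v)`, `ε = -1` exactly at the fourth value, then antisymmetry in `(a,b)` and the pair
symmetry). [folklore] -/
theorem triangle_kill
    (h1 : ∀ a b m n r s, K b a m n r s = -K a b m n r s)
    (h4 : ∀ a b m n r s, K a b r s m n = K a b m n r s)
    (h5 : ∀ (π : Equiv.Perm (Fin 4)) (ε : Fin 4 → ℝ), (∀ i, ε i = 1 ∨ ε i = -1) →
      ((Equiv.Perm.sign π : ℤ) : ℝ) * ∏ i, ε i = 1 →
      ∀ a b m n r s, ε a * ε b * ε m * ε n * ε r * ε s * K (π a) (π b) (π m) (π n) (π r) (π s)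
        = K a b m n r s)
    {u v w : Fin 4} (huv : u ≠ v) (huw : u ≠ w) (hvw : v ≠ w) : K u v u w v w = 0 := by
  obtain ⟨q, hqu, hqv, hqw⟩ : ∃ q : Fin 4, q ≠ u ∧ q ≠ v ∧ q ≠ w := by
    have hall : ∀ i j k : Fin 4, ∃ q : Fin 4, q ≠ i ∧ q ≠ j ∧ q ≠ k := by decide
    exact hall u v w
  have hε1 : ∀ i : Fin 4, (if i = q then (-1 : ℝ) else 1) = 1 ∨
      (if i = q then (-1 : ℝ) else 1) = -1 := by
    intro i; split_ifs <;> simp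
  have hprod : ((Equiv.Perm.sign (Equiv.swap u v) : ℤ) : ℝ) *
      ∏ i : Fin 4, (if i = q then (-1 : ℝ) else 1) = 1 := by
    rw [Equiv.Perm.sign_swap huv, Finset.prod_ite_eq']
    simp
  have key := h5 (Equiv.swap u v) (fun i => if i = q then (-1 : ℝ) else 1) hε1 hprod u v u w v w
  rw [Equiv.swap_apply_left, Equiv.swap_apply_right, Equiv.swap_apply_of_ne_of_ne huw.symm hvw.symm,
    if_neg hqu.symm, if_neg hqv.symm, if_neg hqw.symm, h1 u v v w u w, h4 u v u w v w] at key
  linarith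

/-- The combinatorial heart, as a Boolean evaluation checked by `decide`: every index tuple has a
diagonal pair, or an odd `{0,1}`- or `{0,2}`-count, or is a star or a triangle in one of the eight
orientations inside the three ordered pairs. [folklore] -/
theorem verdict (a b m n r s : Fin 4) :
    (decide (a = b) || decide (m = n) || decide (r = s) ||
      decide (([a, b, m, n, r, s].countP (fun x => decide (x = 0 ∨ x = 1))) % 2 = 1) ||
      decide (([a, b, m, n, r, s].countP (fun x => decide (x = 0 ∨ x = 2))) % 2 = 1) ||
      -- stars, apex `a`
      decide (m = a ∧ r = a ∧ a ≠ b ∧ a ≠ n ∧ a ≠ s ∧ b ≠ n ∧ b ≠ s ∧ n ≠ s) ||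
      decide (m = a ∧ s = a ∧ a ≠ b ∧ a ≠ n ∧ a ≠ r ∧ b ≠ n ∧ b ≠ r ∧ n ≠ r) ||
      decide (n = a ∧ r = a ∧ a ≠ b ∧ a ≠ m ∧ a ≠ s ∧ b ≠ m ∧ b ≠ s ∧ m ≠ s) ||
      decide (n = a ∧ s = a ∧ a ≠ b ∧ a ≠ m ∧ a ≠ r ∧ b ≠ m ∧ b ≠ r ∧ m ≠ r) ||
      -- stars, apex `b`
      decide (m = b ∧ r = b ∧ b ≠ a ∧ b ≠ n ∧ b ≠ s ∧ a ≠ n ∧ a ≠ s ∧ n ≠ s) ||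
      decide (m = b ∧ s = b ∧ b ≠ a ∧ b ≠ n ∧ b ≠ r ∧ a ≠ n ∧ a ≠ r ∧ n ≠ r) ||
      decide (n = b ∧ r = b ∧ b ≠ a ∧ b ≠ m ∧ b ≠ s ∧ a ≠ m ∧ a ≠ s ∧ m ≠ s) ||
      decide (n = b ∧ s = b ∧ b ≠ a ∧ b ≠ m ∧ b ≠ r ∧ a ≠ m ∧ a ≠ r ∧ m ≠ r) ||
      -- triangles, second pair through `a`
      decide (m = a ∧ r = b ∧ s = n ∧ a ≠ b ∧ a ≠ n ∧ b ≠ n) ||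
      decide (m = a ∧ s = b ∧ r = n ∧ a ≠ b ∧ a ≠ n ∧ b ≠ n) ||
      decide (n = a ∧ r = b ∧ s = m ∧ a ≠ b ∧ a ≠ m ∧ b ≠ m) ||
      decide (n = a ∧ s = b ∧ r = m ∧ a ≠ b ∧ a ≠ m ∧ b ≠ m) ||
      -- triangles, second pair through `b`
      decide (m = b ∧ r = a ∧ s = n ∧ a ≠ b ∧ a ≠ n ∧ b ≠ n) ||
      decide (m = b ∧ s = a ∧ r = n ∧ a ≠ b ∧ a ≠ n ∧ b ≠ n) ||
      decide (n = b ∧ r = a ∧ s = m ∧ a ≠ b ∧ a ≠ m ∧ b ≠ m) ||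
      decide (n = b ∧ s = a ∧ r = m ∧ a ≠ b ∧ a ≠ m ∧ b ≠ m)) = true := by
  revert a b m n r s
  decide

end SelectionRule

/-- The W⁺ Λ²-selection rule `Hom_{W⁺}(Sym²Λ², Λ²) = 0` in coordinates: a real tensor
`K a b m n r s`, antisymmetric in `(a,b)`, `(m,n)`, `(r,s)`, symmetric under `(m,n) ↔ (r,s)` and
invariant under the proper hyperoctahedral group (signed permutations `(π, ε)` with
`sign π · ∏ ε = 1`), vanishes identically. [folklore] -/
theorem lambdaTwo_selectionRule : ∀ K : Fin 4 → Fin 4 → Fin 4 → Fin 4 → Fin 4 → Fin 4 → ℝ, (∀ a b m n r s, K b a m n r s = -K a b m n r s) → (∀ a b m n r s, K a b n m r s = -K a b m n r s) → (∀ a b m n r s, K a b m n s r = -K a b m n r s) → (∀ a b m n r s, K a b r s m n = K a b m n r s) → (∀ (π : Equiv.Perm (Fin 4)) (ε : Fin 4 → ℝ), (∀ i, ε i = 1 ∨ ε i = -1) → ((Equiv.Perm.sign π : ℤ) : ℝ) * ∏ i, ε i = 1 → ∀ a b m n r s, ε a * ε b * ε m * ε n * ε r * ε s * K (π a) (π b)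 (π m) (π n) (π r) (π s) = K a b m n r s) → ∀ a b m n r s, K a b m n r s = 0 := by
  intro K h1 h2 h3 h4 h5 a b m n r s
  have hv := SelectionRule.verdict a b m n r s
  simp only [Bool.or_eq_true, decide_eq_true_eq, or_assoc] at hv
  rcases hv with h | h | h | h | h |
      ⟨hm, hr, h₁, h₂, h₃, h₄, h₅, h₆⟩ | ⟨hm, hr, h₁, h₂, h₃, h₄, h₅, h₆⟩ |
      ⟨hm, hr, h₁, h₂, h₃, h₄, h₅, h₆⟩ | ⟨hm, hr, h₁, h₂, h₃, h₄, h₅, h₆⟩ |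
      ⟨hm, hr, h₁, h₂, h₃, h₄, h₅, h₆⟩ | ⟨hm, hr, h₁, h₂, h₃, h₄, h₅, h₆⟩ |
      ⟨hm, hr, h₁, h₂, h₃, h₄, h₅, h₆⟩ | ⟨hm, hr, h₁, h₂, h₃, h₄, h₅, h₆⟩ |
      ⟨hm, hr, hs, h₁, h₂, h₃⟩ | ⟨hm, hr, hs, h₁, h₂, h₃⟩ | ⟨hm, hr, hs, h₁, h₂, h₃⟩ |
      ⟨hm, hr, hs, h₁, h₂, h₃⟩ | ⟨hm, hr, hs, h₁, h₂, h₃⟩ | ⟨hm, hr, hs, h₁, h₂, h₃⟩ |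
      ⟨hm, hr, hs, h₁, h₂, h₃⟩ | ⟨hm, hr, hs, h₁, h₂, h₃⟩
  -- diagonal pairs
  · rw [h]; linarith [h1 b b m n r s]
  · rw [h]; linarith [h2 a b n n r s]
  · rw [h]; linarith [h3 a b m n s s]
  -- double flips along `{0,1}` and `{0,2}`
  · exact SelectionRule.flip_kill h5 (by decide) h
  · exact SelectionRule.flip_kill h5 (by decide) h
  -- stars with apex `a`
  · rw [hm, hr]; exact SelectionRule.star_kill h4 h5 h₁ h₂ h₃ h₄ h₅ h₆
  · rw [hm, hr]; linarith [h3 a b a n a r, SelectionRule.star_kill h4 h5 h₁ h₂ h₃ h₄ h₅ h₆]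
  · rw [hm, hr]; linarith [h2 a b a m a s, SelectionRule.star_kill h4 h5 h₁ h₂ h₃ h₄ h₅ h₆]
  · rw [hm, hr]
    linarith [h2 a b a m r a, h3 a b a m a r, SelectionRule.star_kill h4 h5 h₁ h₂ h₃ h₄ h₅ h₆]
  -- stars with apex `b`
  · rw [hm, hr]; linarith [h1 b a b n b s, SelectionRule.star_kill h4 h5 h₁ h₂ h₃ h₄ h₅ h₆]
  · rw [hm, hr]
    linarith [h1 b a b n r b, h3 b a b n b r, SelectionRule.star_kill h4 h5 h₁ h₂ h₃ h₄ h₅ h₆]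
  · rw [hm, hr]
    linarith [h1 b a m b b s, h2 b a b m b s, SelectionRule.star_kill h4 h5 h₁ h₂ h₃ h₄ h₅ h₆]
  · rw [hm, hr]
    linarith [h1 b a m b r b, h2 b a b m r b, h3 b a b m b r,
      SelectionRule.star_kill h4 h5 h₁ h₂ h₃ h₄ h₅ h₆]
  -- triangles whose second pair passes through `a`
  · rw [hm, hr, hs]; exact SelectionRule.triangle_kill h1 h4 h5 h₁ h₂ h₃
  · rw [hm, hr, hs]; linarith [h3 a b a n b n, SelectionRule.triangle_kill h1 h4 h5 h₁ h₂ h₃]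
  · rw [hm, hr, hs]; linarith [h2 a b a m b m, SelectionRule.triangle_kill h1 h4 h5 h₁ h₂ h₃]
  · rw [hm, hr, hs]
    linarith [h2 a b a m m b, h3 a b a m b m, SelectionRule.triangle_kill h1 h4 h5 h₁ h₂ h₃]
  -- triangles whose second pair passes through `b`
  · rw [hm, hr, hs]; linarith [h4 a b a n b n, SelectionRule.triangle_kill h1 h4 h5 h₁ h₂ h₃]
  · rw [hm, hr, hs]
    linarith [h4 a b n a b n, h2 a b a n b n, SelectionRule.triangle_kill h1 h4 h5 h₁ h₂ h₃]
  · rw [hm, hr, hs]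
    linarith [h4 a b a m m b, h3 a b a m b m, SelectionRule.triangle_kill h1 h4 h5 h₁ h₂ h₃]
  · rw [hm, hr, hs]
    linarith [h4 a b m a m b, h2 a b a m m b, h3 a b a m b m,
      SelectionRule.triangle_kill h1 h4 h5 h₁ h₂ h₃]

end Summit.QuantumFields.YangMills.Cruxes.CurvatureAmnesia.WardDefect
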